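import Summits.QuantumAdvantage.QuantumAdvantage.Theorems.CompactnessPrinciple.Negative.SliceZeroEmpty
import Literature.Computability.Complexity.PaulPippengerSzemerediTrotter1983Clocks
import Literature.Computability.Complexity.StringCopy
import Literature.Computability.Complexity.StackNumeric
import Literature.Computability.QuantumComplexity.BQTime
import HarnessLib

/-!
# Crux `CompactnessPrinciple` (stmt-QuantumAdvantage-15270): `QuadQ ≠ ∅`, so the exponent of the typed crux is tight at `c ≥ 1`

Standing disprover (refuter-cdisprove-stmt-QuantumAdvantage-15270-0, 2026-08-17), tightness section of
`Cruxes/CompactnessPrinciple/Disproof.lean`, landed; makes `Negative/SliceZeroEmpty.lean` UNCONDITIONAL.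

`SliceZeroEmpty.lean` showed `bp (DTIME (fun n => n ^ 0)) = ∅`, whence "`c = 0` witnesses the crux's
conclusion `QuadQ ⊆ bp (DTIME n^c)` iff `QuadQ = ∅`". This file builds an inhabitant of the route's class
`QuadQ = BQTime (fun n => n ^ 2)` (`quadQ_nonempty`, `BQTime_sq_nonempty`) — as far as we can see the
first kernel-checked member of any fixed-time uniform quantum class of the tree — and concludes:

* `not_quadQ_subset_bp_DTIME_pow_zero` — the natural strengthening "`c = 0`" of the crux's conclusion is
  FALSE outright (no hypothesis): `¬ QuadQ ⊆ bp (DTIME (fun n => n ^ 0))`;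
* `exponent_pos` — every witness `c` of the conclusion of `CompactnessPrinciple` has `1 ≤ c`
  (and `c = 1` is attained under `BQP ⊆ BPP` + `H1`, `Disproof.compactnessPrinciple_of_H1`): TIGHT;
* `languageLadder_rung_zero` — rung `c = 0` of the sibling `LanguageLadder` holds unconditionally, so
  (with `Disproof.languageLadder_iff_of_H1`) the typed ladder is exactly "`QuadQ ⊄ BPP`";
* non-vacuity for the REPAIRED route: `BQTime (· ^ 2) ≠ ∅`, i.e. the `∃ L ∈ BQTime(n²)` of `Ladder′` and
  the domain of CP′ are inhabited in the tree's model (uniformity format, unary ancilla count, binary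
  width, halting rule and the `C n² + C` budget are jointly satisfiable).

THE WITNESS. The gate-free family `⟨0 ancillas, no gates⟩` (written as a literal throughout) (identity on `n` wires): its
acceptance probability on `x` is `[ |x| ≥ 1 ∧ x₀ = 1 ] ∈ {0, 1}` (`acceptProb_nil_zero_or_one`: empty
circuit = identity matrix, basis state in, wire `0` out), so `L₀ = {x | 2/3 ≤ Pr[accept x]}` is decided
with the `(2/3, 1/3)` gap; its description `1ⁿ ↦ sigmaEncode ⟨n, 0, []⟩ = ⟨bin n, 01⟩` is computed in
LINEAR time by the pipeline unary→binary counter (`timeComputable_unary_id`, `28 n + 28`) ⨟ `dup`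
(`StrCopy.dupT`) ⨟ `rePair` (`RePairTM`, appends the separator `01`) ⨟ `sepT` (a 3-state transducer
rewriting the separator `01` to `0101`, `sepT_eval_boolPair_nil`, built as a literal inside
`exists_linearTime_pairSep` so that no definition lands in `Theorems/`), glued by `TimeComputable.comp_holds`
(`tc_comp_linear`), hence within `C n² + C`. Sorry-free.
-/

set_option linter.dupNamespace false

namespace Summit.QuantumAdvantage.QuantumAdvantage.Theorems.CompactnessPrinciple.Negative

open Turing Function Polynomial
open _root_.Computability
open Literature.Computability.Complexity Literature.Computability.Cryptography
open Literature.Computability.Complexity.StrCopy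

/-! ### A separator-expanding transducer (hypothetical `T`; instantiated by a literal below)

The transducer has states `Option Bool` (a one-symbol buffer): it reads the input two symbols at a
time, copies equal pairs `cc`, and rewrites an unequal pair (the separator `01` of a well-formed
`⟨z, ε⟩`) to `0101`. To introduce no definition in `Theorems/`, the lemmas are stated for any `T` with
these transitions and the literal is built inside the proof of `exists_linearTime_pairSep`. -/

section SepT

variable (T : FST (Option Bool) Bool Bool)
  (hnone : ∀ c, T.step none c = (some c, []))
  (hsome : ∀ c' c, T.step (some c') c = (none, if c' = c then [c', c] else [false, true, false, true]))
include hnone hsome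

/-- An equal pair is copied. [folklore] -/
theorem sepT_run_pair (b : Bool) (l : List Bool) :
    (T.run none (b :: b :: l)).2 = b :: b :: (T.run none l).2 := by
  simp [FST.run_cons, hnone, hsome]

/-- The separator `01` is doubled. [folklore] -/
theorem sepT_run_sep (l : List Bool) :
    (T.run none (false :: true :: l)).2 = false :: true :: false :: true :: (T.run none l).2 := by
  simp [FST.run_cons, hnone, hsome]

/-- A doubled string is copied. [folklore] -/
theorem sepT_run_dup (z rest : List Bool) :
    (T.run none (dup z ++ rest)).2 = dup z ++ (T.run none rest).2 := by
  induction z with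
  | nil => simp [dup]
  | cons b z ih =>
    simp only [dup, List.flatMap_cons, List.cons_append, List.nil_append] at ih ⊢
    rw [sepT_run_pair T hnone hsome, ih]

/-- **The transducer maps `⟨z, ε⟩` to `⟨z, 01⟩`.** [folklore] -/
theorem sepT_eval_boolPair_nil (hinit : T.init = none) (hfront : ∀ s, T.front s = [])
    (hkeep : ∀ s, T.keep s = true) (z : List Bool) :
    T.eval (boolPair z []) = boolPair z [false, true] := by
  rw [boolPair_eq_dup, boolPair_eq_dup]
  simp only [FST.eval, hinit, hfront, hkeep, if_true, List.nil_append]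
  rw [sepT_run_dup T hnone hsome, sepT_run_sep T hnone hsome]
  simp

end SepT

/-! ### Linear-time string stages in the shape `K (n + 1)` -/

/-- `|dup z| = 2 |z|`. [folklore] -/
theorem length_dup (z : List Bool) : (dup z).length = 2 * z.length := by
  induction z with
  | nil => rfl
  | cons b z ih => simp only [dup, List.flatMap_cons, List.cons_append, List.nil_append,
      List.length_cons] at ih ⊢; omega

/-- `dup` is linear time (`StrCopy.dupT`). [folklore] -/
theorem tc_dup : ∃ K : ℕ, TimeComputable id id dup fun n => K * (n + 1) := by
  have h := (dupT).timeComputable_eval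
  rw [show dupT.eval = dup from funext dupT_eval] at h
  refine ⟨dupT.maxEmit + 4, h.mono fun n => ?_⟩
  generalize dupT.maxEmit = m
  nlinarith [Nat.zero_le (m * n), Nat.zero_le m, Nat.zero_le n]

/-- `rePair` is linear time (`RePairTM`, `4 n + 5` steps). [folklore] -/
theorem tc_rePair : TimeComputable id id rePair fun n => 5 * (n + 1) :=
  ⟨RePairTM.aux, fun z => (RePairTM.outputsWithin z).mono (by simp only [id]; omega)⟩

/-- A finite-state transduction is linear time in the shape `K (n + 1)` (`FST.timeComputable_eval`). [folklore] -/
theorem tc_fst {σ : Type} [Fintype σ] (T : FST σ Bool Bool) :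
    ∃ K : ℕ, TimeComputable id id T.eval fun n => K * (n + 1) := by
  have h := T.timeComputable_eval
  refine ⟨T.maxEmit + 4, h.mono fun n => ?_⟩
  generalize T.maxEmit = m
  nlinarith [Nat.zero_le (m * n), Nat.zero_le m, Nat.zero_le n]

/-- Composition of two linear-time string maps with linear intermediate length is linear time
(`TimeComputable.comp_holds`). [folklore] -/
theorem tc_comp_linear {f g : List Bool → List Bool} {K₁ K₂ K₃ : ℕ}
    (hf : TimeComputable id id f fun n => K₁ * (n + 1))
    (hg : TimeComputable id id g fun n => K₂ * (n + 1))
    (hs : ∀ w, (f w).length ≤ K₃ * (w.length + 1)) :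
    ∃ K : ℕ, TimeComputable id id (g ∘ f) fun n => K * (n + 1) := by
  obtain ⟨c, hc⟩ := TimeComputable.comp_holds (s := fun n => K₃ * (n + 1)) hg hf
    (fun a b hab => Nat.mul_le_mul_left K₂ (Nat.succ_le_succ hab)) (fun w => hs w)
  refine ⟨c * K₁ + c * K₂ * K₃ + c * K₂ + c * K₃ + c, hc.mono fun n => ?_⟩
  have : c * (K₁ * (n + 1) + K₂ * (K₃ * (n + 1) + 1) + K₃ * (n + 1)) + c +
      (c * K₂ * n + c * n) = (c * K₁ + c * K₂ * K₃ + c * K₂ + c * K₃ + c) * (n + 1) := by ring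
  omega

/-- **`w ↦ ⟨w, 01⟩` in linear time**: `dup` ⨟ `rePair` (appends the separator `01`, `rePair_dup`) ⨟
the separator-expanding transducer (built here as a literal). [folklore] -/
theorem exists_linearTime_pairSep : ∃ (Φ : List Bool → List Bool) (K : ℕ),
    (∀ w, Φ w = boolPair w [false, true]) ∧ TimeComputable id id Φ fun n => K * (n + 1) := by
  let T : FST (Option Bool) Bool Bool :=
    ⟨none, fun s c => Option.elim s (some c, []) fun c' =>
      (none, if c' = c then [c', c] else [false, true, false, true]), fun _ => [], fun _ => true⟩
  have hnone : ∀ c, T.step none c = (some c, []) := fun _ => rfl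
  have hsome : ∀ c' c, T.step (some c') c =
      (none, if c' = c then [c', c] else [false, true, false, true]) := fun _ _ => rfl
  obtain ⟨K₁, h₁⟩ := tc_dup
  obtain ⟨K₂, h₂⟩ := tc_comp_linear (K₃ := 2) h₁ tc_rePair fun w => by rw [length_dup]; omega
  obtain ⟨K₃, h₃⟩ := tc_fst T
  obtain ⟨K, hK⟩ := tc_comp_linear (K₃ := 2) h₂ h₃ fun w => by
    simp only [Function.comp, rePair_dup, length_boolPair, List.length_nil]; omega
  refine ⟨T.eval ∘ (rePair ∘ dup), K, fun w => ?_, hK⟩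
  simp only [Function.comp, rePair_dup]
  exact sepT_eval_boolPair_nil T hnone hsome rfl (fun _ => rfl) (fun _ => rfl) w

/-! ### The gate-free family `⟨0 ancillas, no gates⟩` -/

/-- The gate-free family is oracle-free (it has no gates). [folklore] -/
theorem idFamily_isOracleFree : (⟨fun _ => 0, fun _ => ⟨[]⟩⟩ : QCircuitFamily cliffordT).IsOracleFree := by
  intro n g hg
  exact absurd hg List.not_mem_nil

/-- Its description is `⟨bin n, ⟨ε, ε⟩⟩ = ⟨bin n, 01⟩` (definitional). [folklore] -/
theorem sigmaEncode_idFamily (n : ℕ) :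
    QCircuit.sigmaEncode (G := cliffordT)
        ⟨n, (⟨fun _ => 0, fun _ => ⟨[]⟩⟩ : QCircuitFamily cliffordT).ancillas n,
          (⟨fun _ => 0, fun _ => ⟨[]⟩⟩ : QCircuitFamily cliffordT).circ n⟩ =
      boolPair (encodeNat n) [false, true] := rfl

/-- **The gate-free family is `O(n²)`-time uniform** (indeed linear): unary-to-binary counter
(`timeComputable_unary_id`, `28 n + 28`), then `w ↦ ⟨w, 01⟩` (`exists_linearTime_pairSep`), composed by
`TimeComputable.comp_holds` with `|bin n| ≤ n` (`length_encodeNat_le_self`). [folklore] -/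
theorem idFamily_timeUniform : ∃ C : ℕ,
    TimeComputable unaryEncodeNat (QCircuit.sigmaEncode (G := cliffordT))
      (fun n => (⟨n, (⟨fun _ => 0, fun _ => ⟨[]⟩⟩ : QCircuitFamily cliffordT).ancillas n,
        (⟨fun _ => 0, fun _ => ⟨[]⟩⟩ : QCircuitFamily cliffordT).circ n⟩ :
          Σ n m : ℕ, QCircuit cliffordT (n + m)))
      (fun n => C * n ^ 2 + C) := by
  obtain ⟨Φ, K, hΦ, M, hM⟩ := exists_linearTime_pairSep
  -- the string machine, read through the encoders `encodeNat` / `sigmaEncode`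
  have hg : TimeComputable encodeNat (QCircuit.sigmaEncode (G := cliffordT))
      (fun n => (⟨n, (⟨fun _ => 0, fun _ => ⟨[]⟩⟩ : QCircuitFamily cliffordT).ancillas n,
        (⟨fun _ => 0, fun _ => ⟨[]⟩⟩ : QCircuitFamily cliffordT).circ n⟩ :
          Σ n m : ℕ, QCircuit cliffordT (n + m)))
      (fun n => K * (n + 1)) := by
    refine ⟨M, fun n => ?_⟩
    have h := hM (encodeNat n)
    rw [id, hΦ] at h
    rw [sigmaEncode_idFamily]
    exact h
  obtain ⟨c, hc⟩ := TimeComputable.comp_holds (s := fun n => n) hg timeComputable_unary_id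
    (fun a b hab => Nat.mul_le_mul_left K (Nat.succ_le_succ hab))
    (fun n => by
      show (encodeNat n).length ≤ (unaryEncodeNat n).length
      rw [show (unaryEncodeNat n).length = n from unary_decode_encode_nat n]
      exact length_encodeNat_le_self n)
  refine ⟨c * (29 + K), hc.mono fun n => ?_⟩
  have h1 : c * (28 * n + 28 + K * (n + 1) + n) + c = c * (29 + K) * n + c * (29 + K) := by ring
  have h2 : n ≤ n ^ 2 := Nat.le_self_pow two_ne_zero n
  rw [h1]
  exact Nat.add_le_add_right (Nat.mul_le_mul_left _ h2) _

/-! ### Acceptance probabilities of the gate-free family are `0` or `1` -/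

/-- **The empty circuit accepts with probability `0` or `1`**: its matrix is the identity
(`toMatrix_nil`), the input is a basis state, and wire `0` of `|x 0^0⟩` is read off
(`Finset.sum_ite_eq'`); `0` on the empty register. [folklore] -/
theorem acceptProb_nil_zero_or_one (n : ℕ) (v : QReg n) :
    QCircuit.acceptProb (m := 0) 0 (⟨[]⟩ : QCircuit cliffordT (n + 0)) v = 0 ∨
      QCircuit.acceptProb (m := 0) 0 (⟨[]⟩ : QCircuit cliffordT (n + 0)) v = 1 := by
  unfold QCircuit.acceptProb QCircuit.runOn
  by_cases h : 0 < n + 0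
  · simp only [h, dif_pos, QCircuit.toMatrix_nil, Matrix.one_mulVec, basisState_apply]
    set w : QReg (n + 0) := padInput v 0
    have key : ∀ y : QReg (n + 0),
        (if y ⟨0, h⟩ = true then ‖(if y = w then (1 : ℂ) else 0)‖ ^ 2 else (0 : ℝ)) =
          if y = w then (if w ⟨0, h⟩ = true then 1 else 0) else 0 := by
      intro y
      by_cases hy : y = w
      · rw [hy]; by_cases h0 : w ⟨0, h⟩ = true <;> simp [h0]
      · by_cases h0 : y ⟨0, h⟩ = true <;> simp [h0, hy]
    rw [Finset.sum_congr rfl fun y _ => key y, Finset.sum_ite_eq' Finset.univ w]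
    by_cases h0 : w ⟨0, h⟩ = true <;> simp [h0]
  · left
    have hn : n = 0 := by omega
    subst hn
    simp

/-- Acceptance probabilities of the gate-free family are `0` or `1`. [folklore] -/
theorem acceptProbOn_idFamily_zero_or_one (x : List Bool) :
    (⟨fun _ => 0, fun _ => ⟨[]⟩⟩ : QCircuitFamily cliffordT).acceptProbOn 0 x = 0 ∨
      (⟨fun _ => 0, fun _ => ⟨[]⟩⟩ : QCircuitFamily cliffordT).acceptProbOn 0 x = 1 :=
  acceptProb_nil_zero_or_one x.length x.get

/-! ### `QuadQ` is inhabited -/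

/-- **`QuadQ = BQTime(n²)` is nonempty**: the language of the gate-free family (`{x | 2/3 ≤ Pr[accept x]}`
= strings whose first bit is `1`) is decided with the `(2/3, 1/3)` gap (probabilities are `0`/`1`) by an
`O(n²)`-uniform oracle-free Clifford+T family. [folklore] -/
theorem quadQ_nonempty : Set.Nonempty {L : Language Bool | ∃ F : QCircuitFamily cliffordT, F.IsOracleFree ∧
      (∃ C : ℕ, TimeComputable _root_.Computability.unaryEncodeNat (QCircuit.sigmaEncode (G := cliffordT))
        (fun n => (⟨n, F.ancillas n, F.circ n⟩ : Σ n m : ℕ, QCircuit cliffordT (n + m)))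
        (fun n => C * n ^ 2 + C)) ∧
      ∀ x, (x ∈ L → 2 / 3 ≤ F.acceptProbOn 0 x) ∧ (x ∉ L → F.acceptProbOn 0 x ≤ 1 / 3)} := by
  refine ⟨{x : List Bool | (2 : ℝ) / 3 ≤ (⟨fun _ => 0, fun _ => ⟨[]⟩⟩ : QCircuitFamily cliffordT).acceptProbOn 0 x},
    ⟨fun _ => 0, fun _ => ⟨[]⟩⟩, idFamily_isOracleFree, idFamily_timeUniform,
    fun x => ⟨fun hx => hx, fun hx => ?_⟩⟩
  rcases acceptProbOn_idFamily_zero_or_one x with h | h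
  · rw [h]; norm_num
  · exact absurd (show (2 : ℝ) / 3 ≤ (⟨fun _ => 0, fun _ => ⟨[]⟩⟩ : QCircuitFamily cliffordT).acceptProbOn 0 x
      by rw [h]; norm_num) hx

/-- **`BQTime(n²) ≠ ∅`** (the class of the repaired route; `QuadQ = BQTime (· ^ 2)` by `rfl`). [folklore] -/
theorem BQTime_sq_nonempty : (Literature.Computability.QuantumComplexity.BQTime fun n => n ^ 2).Nonempty :=
  quadQ_nonempty

/-! ### Tightness of the typed crux, unconditionally -/

/-- **The natural strengthening `c = 0` of the crux's conclusion is FALSE**: `QuadQ ⊄ bp (DTIME n^0)`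
(the slice is empty, `SliceZeroEmpty.subset_bp_DTIME_pow_zero_iff`, and `QuadQ ≠ ∅`). [folklore] -/
theorem not_quadQ_subset_bp_DTIME_pow_zero :
    ¬ {L : Language Bool | ∃ F : QCircuitFamily cliffordT, F.IsOracleFree ∧
      (∃ C : ℕ, TimeComputable _root_.Computability.unaryEncodeNat (QCircuit.sigmaEncode (G := cliffordT))
        (fun n => (⟨n, F.ancillas n, F.circ n⟩ : Σ n m : ℕ, QCircuit cliffordT (n + m)))
        (fun n => C * n ^ 2 + C)) ∧
      ∀ x, (x ∈ L → 2 / 3 ≤ F.acceptProbOn 0 x) ∧ (x ∉ L → F.acceptProbOn 0 x ≤ 1 / 3)} ⊆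
      bp (DTIME fun n => n ^ 0) := fun h =>
  quadQ_nonempty.ne_empty ((subset_bp_DTIME_pow_zero_iff _).1 h)

/-- **The exponent of `CompactnessPrinciple` is tight at `1`**: every `c` witnessing its conclusion
`QuadQ ⊆ bp (DTIME (fun n => n ^ c))` has `1 ≤ c` — unconditionally (`exponent_pos_of_subset_bp_DTIME_pow`
+ `quadQ_nonempty`); `c = 1` is attained under `BQP ⊆ BPP` and `H1` (`Disproof.compactnessPrinciple_of_H1`). [folklore] -/
theorem exponent_pos {c : ℕ}
    (hc : {L : Language Bool | ∃ F : QCircuitFamily cliffordT, F.IsOracleFree ∧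
      (∃ C : ℕ, TimeComputable _root_.Computability.unaryEncodeNat (QCircuit.sigmaEncode (G := cliffordT))
        (fun n => (⟨n, F.ancillas n, F.circ n⟩ : Σ n m : ℕ, QCircuit cliffordT (n + m)))
        (fun n => C * n ^ 2 + C)) ∧
      ∀ x, (x ∈ L → 2 / 3 ≤ F.acceptProbOn 0 x) ∧ (x ∉ L → F.acceptProbOn 0 x ≤ 1 / 3)} ⊆
      bp (DTIME fun n => n ^ c)) : 1 ≤ c :=
  exponent_pos_of_subset_bp_DTIME_pow quadQ_nonempty hc

/-- **Rung `c = 0` of the sibling crux `LanguageLadder` holds** (unconditionally: the slice is empty and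
`QuadQ ≠ ∅`); with `Disproof.languageLadder_iff_of_H1` the typed ladder is exactly `QuadQ ⊄ BPP`. [folklore] -/
theorem languageLadder_rung_zero :
    ∃ L ∈ {L : Language Bool | ∃ F : QCircuitFamily cliffordT, F.IsOracleFree ∧
      (∃ C : ℕ, TimeComputable _root_.Computability.unaryEncodeNat (QCircuit.sigmaEncode (G := cliffordT))
        (fun n => (⟨n, F.ancillas n, F.circ n⟩ : Σ n m : ℕ, QCircuit cliffordT (n + m)))
        (fun n => C * n ^ 2 + C)) ∧
      ∀ x, (x ∈ L → 2 / 3 ≤ F.acceptProbOn 0 x) ∧ (x ∉ L → F.acceptProbOn 0 x ≤ 1 / 3)},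
      L ∉ bp (DTIME fun n => n ^ 0) :=
  (exists_not_mem_bp_DTIME_pow_zero_iff _).2 quadQ_nonempty

end Summit.QuantumAdvantage.QuantumAdvantage.Theorems.CompactnessPrinciple.Negative
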